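import Summits.AtomisticToContinuum.Crystallization.Theorems.OverbindingBudgetAffineFarFieldCellLedgerIdeal
import Summits.AtomisticToContinuum.Crystallization.Theorems.OverbindingBudgetAffineFarFieldCellVoronoi
import Literature.Geometry.DiscreteGeometry.KissingPatterns

/-!
# Overbinding budget — far-field Voronoi cells, part 27V «CellVoronoiSandwich»: HALF-SPACE FORMS

Route `OverbindingBudget`, crux `RobustDefectLimitWindows` (stmt-31280), line (2c), leaf SW♭(30),
part 27V — the CONVENTION-BOUND companion of the sandwich certificate (CellVoronoi).  It ties the
three conventions of the line together BY NAME: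

* the route's local structure — the Literature kissing patterns `fccKissingPattern` /
  `hcpKissingPattern : Finset ℝ³` (twelve unit vectors; `ShellCloseTo η T P` matches a recentred,
  rescaled shell `T` to `P` after a linear isometry)
  [Literature.Geometry.DiscreteGeometry.KissingPatterns];
* the certificate's shell family — `patternStar P ν : ↥P → ℝ³`, `x ↦ ν·x`, the first-shell star
  of the pattern at nearest-neighbour distance `ν` (`‖patternStar P ν x‖ = ν`), and its cells
  `shellCell (patternStar P ν) c = {u | ⟪u, x⟫ ≤ cν/2 ∀ x ∈ P}` (CellVoronoi);
* the ledger's ideal cells — `idealCell true ν = rdCell (ν/(2√2))` (rhombic dodecahedron) and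
  `idealCell false ν = trdCell (ν/(2√2))` (trapezo-rhombic dodecahedron)
  (CellLedgerIdeal, CellRD, CellTRD).

Main statements (`0 < ν`, any real `c`):
`shellCell (patternStar fccKissingPattern ν) c = idealCell true (c·ν)` (`shellCell_fcc`) and
`shellCell (patternStar hcpKissingPattern ν) c = idealCell false (c·ν)` (`shellCell_hcp`): the
twelve fcc half-spaces `±uᵢ ± uⱼ ≤ cν/√2` are the rhombic dodecahedron; the twelve hcp half-spaces
(six in-plane `±(uᵢ − uⱼ)`, three upper `uᵢ + uⱼ`, three lower `(−uᵢ − uⱼ − 4u_k)/3`, all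
`≤ cν/√2`, in the cuboctahedron frame of `hcpInt`) are the half-twisted cell `trdCell`: on
`Σu ≥ 0` they are equivalent to the fcc ones, on `Σu < 0` to the fcc ones for the half-turn
`(2/3)(Σu)(1,1,1) − u` (CellTwist).  Plus the data the certificate asks of a shell family: norms
`ν`, `Nonempty` index types, and the circumradius `shellCell _ 1 ⊆ closedBall 0 (ν/√2)`,
`(ν/√2)² ≤ ν²/2`.
-/

namespace Summit.AtomisticToContinuum.Crystallization.Theorems.OverbindingBudgetAffineFarFieldCellShell

noncomputable section

open Set
open Literature.Geometry.DiscreteGeometry (intVec intVec_apply scaledPattern fccInt hcpInt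
  fccKissingPattern hcpKissingPattern norm_eq_one_of_mem_fccKissingPattern
  norm_eq_one_of_mem_hcpKissingPattern card_fccKissingPattern card_hcpKissingPattern)
open Literature.Barriers.AtomisticToContinuum (sqrt_eighteen)
open Summit.AtomisticToContinuum.Crystallization.Theorems.OverbindingBudgetAffineFarFieldCellRD
open Summit.AtomisticToContinuum.Crystallization.Theorems.OverbindingBudgetAffineFarFieldCellTwist
open Summit.AtomisticToContinuum.Crystallization.Theorems.OverbindingBudgetAffineFarFieldCellTRD
open Summit.AtomisticToContinuum.Crystallization.Theorems.OverbindingBudgetAffineFarFieldCellLedgerIdeal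
open Summit.AtomisticToContinuum.Crystallization.Theorems.OverbindingBudgetAffineFarFieldCellVoronoi

local notation "E3" => EuclideanSpace ℝ (Fin 3)

/-! ## The star of a kissing pattern -/

/-- support: the first-shell STAR of a pattern `P ⊆ ℝ³` at nearest-neighbour distance `ν`:
`x ↦ ν·x` on `↥P`. -/
def patternStar (P : Finset E3) (ν : ℝ) : ↥P → E3 := fun x => ν • (x : E3)

/-- Unfolding `patternStar`: the star point over `x` is `ν • x`. -/
@[simp] theorem patternStar_apply (P : Finset E3) (ν : ℝ) (x : ↥P) :
    patternStar P ν x = ν • (x : E3) := rfl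

/-- The star of a unit pattern has all norms `ν` (`0 ≤ ν`). -/
theorem norm_patternStar {P : Finset E3} (hP : ∀ x ∈ P, ‖x‖ = 1) {ν : ℝ} (hν : 0 ≤ ν)
    (x : ↥P) : ‖patternStar P ν x‖ = ν := by
  rw [patternStar_apply, norm_smul, hP x x.2, mul_one, Real.norm_of_nonneg hν]

/-- The fcc star at scale `ν ≥ 0` has all norms `ν`. -/
theorem norm_patternStar_fcc {ν : ℝ} (hν : 0 ≤ ν) (x : ↥fccKissingPattern) :
    ‖patternStar fccKissingPattern ν x‖ = ν :=
  norm_patternStar (fun _ hx => norm_eq_one_of_mem_fccKissingPattern hx) hν x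

/-- The hcp star at scale `ν ≥ 0` has all norms `ν`. -/
theorem norm_patternStar_hcp {ν : ℝ} (hν : 0 ≤ ν) (x : ↥hcpKissingPattern) :
    ‖patternStar hcpKissingPattern ν x‖ = ν :=
  norm_patternStar (fun _ hx => norm_eq_one_of_mem_hcpKissingPattern hx) hν x

/-- The fcc kissing pattern is nonempty (it has `12` points). -/
theorem nonempty_fccKissingPattern : Nonempty ↥fccKissingPattern :=
  (Finset.card_pos.1 (by rw [card_fccKissingPattern]; norm_num)).coe_sort

/-- The hcp kissing pattern is nonempty (it has `12` points). -/
theorem nonempty_hcpKissingPattern : Nonempty ↥hcpKissingPattern :=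
  (Finset.card_pos.1 (by rw [card_hcpKissingPattern]; norm_num)).coe_sort

/-- Membership in the shell cell of a unit pattern at scale `c`: `⟪u, x⟫ ≤ cν/2` for all `x ∈ P`. -/
theorem mem_shellCell_patternStar_iff {P : Finset E3} (hP : ∀ x ∈ P, ‖x‖ = 1) {ν : ℝ}
    (hν : 0 < ν) (c : ℝ) (u : E3) :
    u ∈ shellCell (patternStar P ν) c ↔ ∀ x ∈ P, inner ℝ u x ≤ c * ν / 2 := by
  rw [mem_shellCell, Subtype.forall]
  refine forall₂_congr fun x hx => ?_
  rw [patternStar_apply, real_inner_smul_right, norm_smul, Real.norm_of_nonneg hν.le, hP x hx, mul_one,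
    show c * ν ^ 2 / 2 = ν * (c * ν / 2) by ring]
  exact ⟨fun H => le_of_mul_le_mul_left H hν, fun H => mul_le_mul_of_nonneg_left H hν.le⟩

/-- Over a scaled integer pattern `{v/√N}` the conditions `⟪u, x⟫ ≤ t` read `⟪u, v⟫ ≤ √N·t`. -/
theorem forall_mem_scaledPattern_iff (S : Finset (Fin 3 → ℤ)) {N : ℕ} (hN : N ≠ 0) (u : E3)
    (t : ℝ) : (∀ x ∈ scaledPattern S N, inner ℝ u x ≤ t)
      ↔ ∀ v ∈ S, inner ℝ u (intVec v) ≤ Real.sqrt N * t := by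
  rw [scaledPattern, Finset.forall_mem_image]
  have hpos : 0 < Real.sqrt N := Real.sqrt_pos.2 (by exact_mod_cast Nat.pos_of_ne_zero hN)
  refine forall₂_congr fun v _ => ?_
  rw [real_inner_smul_right, inv_mul_le_iff₀ hpos]

/-- The pairing with an integer vector, in coordinates. -/
theorem inner_intVec_right (u : E3) (v : Fin 3 → ℤ) :
    inner ℝ u (intVec v) = (v 0 : ℝ) * u 0 + (v 1 : ℝ) * u 1 + (v 2 : ℝ) * u 2 := by
  simp only [EuclideanSpace.inner_eq_star_dotProduct, dotProduct, Fin.sum_univ_three, intVec_apply,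
    star_trivial]

/-- `|a| + |b| ≤ t` iff the four signed sums are `≤ t`. -/
theorem abs_add_abs_le_iff (a b t : ℝ) :
    |a| + |b| ≤ t ↔ a + b ≤ t ∧ a - b ≤ t ∧ -a + b ≤ t ∧ -a - b ≤ t := by
  constructor
  · intro H
    refine ⟨?_, ?_, ?_, ?_⟩ <;> linarith [le_abs_self a, neg_le_abs a, le_abs_self b, neg_le_abs b]
  · rintro ⟨h1, h2, h3, h4⟩
    rcases abs_cases a with ⟨ha, -⟩ | ⟨ha, -⟩ <;>
      rcases abs_cases b with ⟨hb, -⟩ | ⟨hb, -⟩ <;> rw [ha, hb] <;> linarith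

/-! ## The fcc star spans the rhombic dodecahedron -/

/-- ★ In the cubic frame with `ν = 2√2·h`:
`shellCell (patternStar fccKissingPattern (2√2·h)) c = rdCell (c·h)` — the twelve half-spaces
`±uᵢ ± uⱼ ≤ 2ch` ARE `|uᵢ| + |uⱼ| ≤ 2ch`. -/
theorem shellCell_fcc_frame {h : ℝ} (hh : 0 < h) (c : ℝ) :
    shellCell (patternStar fccKissingPattern (2 * Real.sqrt 2 * h)) c = rdCell (c * h) := by
  have hν : 0 < 2 * Real.sqrt 2 * h := by positivity
  have ht : Real.sqrt ((2 : ℕ) : ℝ) * (c * (2 * Real.sqrt 2 * h) / 2) = 2 * (c * h) := by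
    rw [Nat.cast_ofNat, show Real.sqrt 2 * (c * (2 * Real.sqrt 2 * h) / 2)
      = Real.sqrt 2 * Real.sqrt 2 * (c * h) by ring, Real.mul_self_sqrt zero_le_two]
  ext u
  rw [mem_shellCell_patternStar_iff (fun _ hx => norm_eq_one_of_mem_fccKissingPattern hx) hν,
    fccKissingPattern, forall_mem_scaledPattern_iff _ two_ne_zero, ht, mem_rdCell_iff]
  simp only [fccInt, Finset.forall_mem_insert, Finset.mem_singleton, forall_eq, inner_intVec_right,
    Matrix.cons_val_zero, Matrix.cons_val_one, Matrix.cons_val_two, Matrix.head_cons, Matrix.tail_cons,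
    Int.cast_one, Int.cast_zero, Int.cast_neg, abs_add_abs_le_iff]
  constructor
  · rintro ⟨f1, f2, f3, f4, f5, f6, f7, f8, f9, f10, f11, f12⟩
    refine ⟨⟨?_, ?_, ?_, ?_⟩, ⟨?_, ?_, ?_, ?_⟩, ⟨?_, ?_, ?_, ?_⟩⟩ <;> linarith
  · rintro ⟨⟨a1, a2, a3, a4⟩, ⟨b1, b2, b3, b4⟩, ⟨c1, c2, c3, c4⟩⟩
    refine ⟨?_, ?_, ?_, ?_, ?_, ?_, ?_, ?_, ?_, ?_, ?_, ?_⟩ <;> linarith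

/-- ★ `shellCell (patternStar fccKissingPattern ν) c = idealCell true (c·ν)` (`0 < ν`, any `c`):
the scaled fcc shell cells of the certificate ARE the ideal `k`-cells of the ledger. -/
theorem shellCell_fcc {ν : ℝ} (hν : 0 < ν) (c : ℝ) :
    shellCell (patternStar fccKissingPattern ν) c = idealCell true (c * ν) := by
  have h0 : 0 < ν / (2 * Real.sqrt 2) := by positivity
  have e : 2 * Real.sqrt 2 * (ν / (2 * Real.sqrt 2)) = ν := mul_div_cancel₀ ν (by positivity)
  change _ = rdCell (c * ν / (2 * Real.sqrt 2))
  rw [show c * ν / (2 * Real.sqrt 2) = c * (ν / (2 * Real.sqrt 2)) by ring,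
    ← shellCell_fcc_frame h0 c, e]

/-- The unit fcc shell cell lies in the closed ball of radius `ν/√2` (its circumradius). -/
theorem shellCell_fcc_subset_closedBall {ν : ℝ} (hν : 0 < ν) :
    shellCell (patternStar fccKissingPattern ν) 1 ⊆ Metric.closedBall 0 (ν / Real.sqrt 2) := by
  rw [shellCell_fcc hν, one_mul]
  exact rdCell_nu_subset_closedBall hν.le

/-- The circumradius relation `r² ≤ ν²/2` of the certificate at `r = ν/√2` (with equality). -/
theorem circumradius_sq (ν : ℝ) : (ν / Real.sqrt 2) ^ 2 ≤ ν ^ 2 / 2 := by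
  rw [div_pow, Real.sq_sqrt zero_le_two]

/-! ## The hcp star spans the trapezo-rhombic dodecahedron -/

/-- ★ In the cubic frame with `ν = 2√2·h`:
`shellCell (patternStar hcpKissingPattern (2√2·h)) c = trdCell (c·h)`. -/
theorem shellCell_hcp_frame {h : ℝ} (hh : 0 < h) (c : ℝ) :
    shellCell (patternStar hcpKissingPattern (2 * Real.sqrt 2 * h)) c = trdCell (c * h) := by
  have hν : 0 < 2 * Real.sqrt 2 * h := by positivity
  have ht : Real.sqrt ((18 : ℕ) : ℝ) * (c * (2 * Real.sqrt 2 * h) / 2) = 3 * (2 * (c * h)) := by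
    rw [Nat.cast_ofNat, sqrt_eighteen, show 3 * Real.sqrt 2 * (c * (2 * Real.sqrt 2 * h) / 2)
      = 3 * (Real.sqrt 2 * Real.sqrt 2) * (c * h) by ring, Real.mul_self_sqrt zero_le_two]
    ring
  ext u
  rw [mem_shellCell_patternStar_iff (fun _ hx => norm_eq_one_of_mem_hcpKissingPattern hx) hν,
    hcpKissingPattern, forall_mem_scaledPattern_iff _ (by norm_num), ht]
  simp only [hcpInt, Finset.forall_mem_insert, Finset.mem_singleton, forall_eq, inner_intVec_right,
    Matrix.cons_val_zero, Matrix.cons_val_one, Matrix.cons_val_two, Matrix.head_cons, Matrix.tail_cons,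
    Int.cast_one, Int.cast_zero, Int.cast_neg, Int.cast_ofNat]
  rcases le_or_gt 0 (axSumL u) with hs | hs
  · rw [mem_trdCell_of_nonneg hs, mem_rdCell_iff]
    rw [axSumL_apply] at hs
    simp only [abs_add_abs_le_iff]
    constructor
    · rintro ⟨i1, i2, i3, i4, i5, i6, p1, p2, p3, l1, l2, l3⟩
      refine ⟨⟨?_, ?_, ?_, ?_⟩, ⟨?_, ?_, ?_, ?_⟩, ⟨?_, ?_, ?_, ?_⟩⟩ <;> linarith
    · rintro ⟨⟨a1, a2, a3, a4⟩, ⟨b1, b2, b3, b4⟩, ⟨c1, c2, c3, c4⟩⟩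
      refine ⟨?_, ?_, ?_, ?_, ?_, ?_, ?_, ?_, ?_, ?_, ?_, ?_⟩ <;> linarith
  · rw [mem_trdCell_of_neg hs, mem_rdCell_iff]
    rw [axSumL_apply] at hs
    simp only [halfTurn_apply, abs_add_abs_le_iff]
    constructor
    · rintro ⟨i1, i2, i3, i4, i5, i6, p1, p2, p3, l1, l2, l3⟩
      refine ⟨⟨?_, ?_, ?_, ?_⟩, ⟨?_, ?_, ?_, ?_⟩, ⟨?_, ?_, ?_, ?_⟩⟩ <;> linarith
    · rintro ⟨⟨a1, a2, a3, a4⟩, ⟨b1, b2, b3, b4⟩, ⟨c1, c2, c3, c4⟩⟩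
      refine ⟨?_, ?_, ?_, ?_, ?_, ?_, ?_, ?_, ?_, ?_, ?_, ?_⟩ <;> linarith

/-- ★ `shellCell (patternStar hcpKissingPattern ν) c = idealCell false (c·ν)` (`0 < ν`, any `c`):
the scaled hcp shell cells of the certificate ARE the ideal `h`-cells of the ledger. -/
theorem shellCell_hcp {ν : ℝ} (hν : 0 < ν) (c : ℝ) :
    shellCell (patternStar hcpKissingPattern ν) c = idealCell false (c * ν) := by
  have h0 : 0 < ν / (2 * Real.sqrt 2) := by positivity
  have e : 2 * Real.sqrt 2 * (ν / (2 * Real.sqrt 2)) = ν := mul_div_cancel₀ ν (by positivity)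
  change _ = trdCell (c * ν / (2 * Real.sqrt 2))
  rw [show c * ν / (2 * Real.sqrt 2) = c * (ν / (2 * Real.sqrt 2)) by ring,
    ← shellCell_hcp_frame h0 c, e]

/-- The unit hcp shell cell lies in the closed ball of radius `ν/√2` (its circumradius). -/
theorem shellCell_hcp_subset_closedBall {ν : ℝ} (hν : 0 < ν) :
    shellCell (patternStar hcpKissingPattern ν) 1 ⊆ Metric.closedBall 0 (ν / Real.sqrt 2) := by
  rw [shellCell_hcp hν, one_mul]
  exact trdCell_nu_subset_closedBall hν.le

/-- Uniform form: `shellCell (patternStar (pattern b) ν) c = idealCell b (c·ν)` for both letters. -/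
theorem shellCell_pattern {ν : ℝ} (hν : 0 < ν) (c : ℝ) (b : Bool) :
    shellCell (patternStar (bif b then fccKissingPattern else hcpKissingPattern) ν) c
      = idealCell b (c * ν) := by
  cases b
  · exact shellCell_hcp hν c
  · exact shellCell_fcc hν c

end

end Summit.AtomisticToContinuum.Crystallization.Theorems.OverbindingBudgetAffineFarFieldCellShell
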